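import Mathlib
import Literature.NumberTheory.LFunctions.Zhang2022.Section16ACalM2Local
import HarnessLib

/-!
# Zhang (2022) §16 p. 91: `ℳ₂(d,l;s)` is analytic on `σ > 9/10` and `≪ ∏_{q∣dl}(1 + cq^{−9/10})` there —
# the nodes `Step16_u021an` and `Step16_u022` HOLD (every `c′`)

Topic `Literature/NumberTheory/LFunctions/Zhang2022` (Landau–Siegel audit tree; verdict-neutral).
Y. Zhang, *Discrete mean estimates and the Landau–Siegel zero*, arXiv:2211.02515v1 (2022)
[Zhang2022LandauSiegel] — **an unrefereed manuscript under adjudication; nothing in this file asserts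
or denies its Theorems 1–2.** §16 p. 91 (tex L4537–L4541), DAG nodes `Z22:§16.u021` (analytic part,
typed `Typed.Section16A.Step16_u021an`) and `Z22:§16.u022` (typed `Typed.Section16A.Step16_u022`):

> It can be verified, for `σ > 9/10`, that the function `ℳ₂(d,l;s) := …` is analytic and it satisfies
> `ℳ₂(d,l;s) ≪ ∏_{q∣dl}(1 + cq^{−9/10})`.

With the local facts of `Section16ACalM2Local` (every prime `q`, every `σ ≥ 9/10`:
`‖F_q(s) − 1‖ ≤ 225q^{−σ}/q` if `q ∤ dl`, `‖F_q(s) − 1‖ ≤ 900q^{−σ}` always; each `F_q` holomorphic on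
`σ > 9/10`), the verification is the §15 one (`Section15BCalM1Analytic`, `Section15BStep15u035`, the
tree's proofs of the twin nodes §15.u034/u035 for `ℳ₁`): a product `∏'_q F_q(s)` of holomorphic
factors with `‖F_q(s) − 1‖ ≤ b_q` on an open set, `Σ b_q < ∞`, converges and is holomorphic there
(uniform convergence of the partial products), and every partial product — hence the limit — is
bounded by `∏(1 + b_q) ≤ exp(Σ_{q∤dl} b_q)·∏_{q∣dl}(1 + 900q^{−9/10})`. Here
`b_q = 225q^{−19/10} + [q ∣ dl]·900q^{−9/10}`. PROVED, for EVERY modulus `D`, every Dirichlet character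
`χ`, all `d, l ≥ 1` (no largeness, no Assumption (A)):

* `calM2_multipliable_differentiableOn` — the Euler product `calM2 c′ χ d l s = ∏'_q calM2Factor …`
  converges for `σ > 9/10` and `s ↦ ℳ₂(d,l;s)` is holomorphic on `{σ > 9/10}`;
* `norm_calM2_le` — `‖ℳ₂(d,l;s)‖ ≤ K·∏_{q∣dl}(1 + 900/q^{9/10})`, `K = exp(225·Σ'_q q^{−19/10})`;
* **`step16_u021an_holds : Step16_u021an c′`**, **`step16_u022_holds : Step16_u022 c′`** (with
  `c = 900`, `C = K`) — the two typed nodes BY NAME, for every `c′`.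

Theorems only: no definition, no claim node, no named fact; axioms standard. WHAT THIS IS NOT: a proof
of the identity part of u021 on `σ > 1` (that is the tree's `Section16ACalM2.step16_u021_holds`), of
u023/(16.10)/(16.12), or of anything about Theorems 1–2 of the source or Landau–Siegel zeros.

## References

* Y. Zhang, arXiv:2211.02515v1 (2022), §16 p. 91 (u021, u022); §15 p. 84 (the parallel `ℳ₁`).
  [cite: Zhang2022LandauSiegel, §16 p. 91]
-/

noncomputable section

open Complex Real Filter Topology
open Literature.NumberTheory.LFunctions.Zhang2022
open Literature.NumberTheory.LFunctions.Zhang2022.Skeleton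

namespace Literature.NumberTheory.LFunctions.Zhang2022.Typed.Section16A

/-! ## §1. Products of holomorphic factors close to `1` (generic; as in `Section15BCalM1Analytic`) -/

/-- `‖∏_{i∈A} g(i) − 1‖ ≤ exp(Σ_{i∈A} ‖g(i) − 1‖) − 1` (Mathlib's
`Finset.norm_prod_one_add_sub_one_le`). [folklore] -/
private theorem norm_prod_sub_one_le {ι : Type*} (A : Finset ι) (g : ι → ℂ) :
    ‖∏ i ∈ A, g i - 1‖ ≤ Real.exp (∑ i ∈ A, ‖g i - 1‖) - 1 := by
  have h := A.norm_prod_one_add_sub_one_le (fun i => g i - 1)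
  simpa only [add_sub_cancel] using h

/-- `‖∏_{i∈A} F i‖ ≤ ∏_{i∈A} (1 + ‖F i − 1‖)`. [folklore] -/
private theorem norm_prod_le_prod_one_add_norm_sub_one {ι : Type*} (A : Finset ι) (F : ι → ℂ) :
    ‖∏ i ∈ A, F i‖ ≤ ∏ i ∈ A, (1 + ‖F i - 1‖) := by
  rw [norm_prod]
  refine Finset.prod_le_prod (fun i _ => norm_nonneg _) fun i _ => ?_
  calc ‖F i‖ = ‖(F i - 1) + 1‖ := by rw [sub_add_cancel]
    _ ≤ ‖F i - 1‖ + ‖(1 : ℂ)‖ := norm_add_le _ _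
    _ = 1 + ‖F i - 1‖ := by rw [norm_one, add_comm]

/-- `∏_{i∈A} (1 + x i) ≤ exp (Σ_{i∈A} x i)` for `x ≥ 0`. [folklore] -/
private theorem prod_one_add_le_exp_sum {ι : Type*} (A : Finset ι) {x : ι → ℝ} (hx : ∀ i, 0 ≤ x i) :
    ∏ i ∈ A, (1 + x i) ≤ Real.exp (∑ i ∈ A, x i) := by
  rw [Real.exp_sum]
  exact Finset.prod_le_prod (fun i _ => by linarith [hx i]) fun i _ => by
    linarith [Real.add_one_le_exp (x i)]

/-- `1 ≤ ∏_{i∈s} f i` when every `f i ≥ 1` (real version). [folklore] -/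
private theorem one_le_prod_real {ι : Type*} (s : Finset ι) {f : ι → ℝ} (h : ∀ i ∈ s, 1 ≤ f i) :
    1 ≤ ∏ i ∈ s, f i :=
  calc (1 : ℝ) = ∏ _i ∈ s, (1 : ℝ) := Finset.prod_const_one.symm
    _ ≤ ∏ i ∈ s, f i := Finset.prod_le_prod (fun _ _ => zero_le_one) h

/-- A sub-product of factors `≥ 1` is bounded by the full product (real version). [folklore] -/
private theorem prod_le_prod_of_subset_of_one_le_real {ι : Type*} [DecidableEq ι] {s t : Finset ι}
    (hst : s ⊆ t) {f : ι → ℝ} (h1 : ∀ i ∈ t, 1 ≤ f i) : ∏ i ∈ s, f i ≤ ∏ i ∈ t, f i := by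
  rw [← Finset.prod_sdiff hst]
  have hs0 : 0 ≤ ∏ i ∈ s, f i := Finset.prod_nonneg fun i hi => zero_le_one.trans (h1 i (hst hi))
  have h := one_le_prod_real (t \ s) (f := f) fun i hi => h1 i (Finset.mem_sdiff.mp hi).1
  exact le_mul_of_one_le_left hs0 h

/-- Tail control for an unconditional product: `∏' F = a`, `b ≥ 0` summable, `‖F(i) − 1‖ ≤ b(i)` off
`S` ⇒ `‖a − ∏_S F‖ ≤ ‖∏_S F‖·(exp(Σ' b) − 1)`. [folklore] -/
private theorem norm_hasProd_sub_prod_le {ι : Type*} {F : ι → ℂ} {a : ℂ} (hF : HasProd F a)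
    (S : Finset ι) {b : ι → ℝ} (hb0 : ∀ i, 0 ≤ b i) (hb : Summable b)
    (hFb : ∀ i ∉ S, ‖F i - 1‖ ≤ b i) :
    ‖a - ∏ i ∈ S, F i‖ ≤ ‖∏ i ∈ S, F i‖ * (Real.exp (∑' i, b i) - 1) := by
  classical
  set P := ∏ i ∈ S, F i with hPdef
  set R := ‖P‖ * (Real.exp (∑' i, b i) - 1) with hRdef
  have hA : ∀ A : Finset ι, S ≤ A → ‖∏ i ∈ A, F i - P‖ ≤ R := by
    intro A hSA
    have hsplit : ∏ i ∈ A, F i = P * ∏ i ∈ A \ S, F i := by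
      rw [hPdef, ← Finset.prod_sdiff hSA, mul_comm]
    have h1 : ‖∏ i ∈ A \ S, F i - 1‖ ≤ Real.exp (∑' i, b i) - 1 := by
      refine (norm_prod_sub_one_le _ _).trans ?_
      have hle : ∑ i ∈ A \ S, ‖F i - 1‖ ≤ ∑' i, b i :=
        calc ∑ i ∈ A \ S, ‖F i - 1‖ ≤ ∑ i ∈ A \ S, b i :=
              Finset.sum_le_sum fun i hi => hFb i (Finset.mem_sdiff.mp hi).2
          _ ≤ ∑' i, b i := hb.sum_le_tsum _ (fun i _ => hb0 i)
      linarith [Real.exp_le_exp.mpr hle]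
    calc ‖∏ i ∈ A, F i - P‖ = ‖P * (∏ i ∈ A \ S, F i - 1)‖ := by rw [hsplit]; ring_nf
      _ = ‖P‖ * ‖∏ i ∈ A \ S, F i - 1‖ := norm_mul _ _
      _ ≤ R := mul_le_mul_of_nonneg_left h1 (norm_nonneg _)
  have hT : Tendsto (fun A : Finset ι => ∏ i ∈ A, F i) atTop (𝓝 a) := hF
  have hclosed : IsClosed {z : ℂ | ‖z - P‖ ≤ R} :=
    isClosed_le (continuous_id.sub continuous_const).norm continuous_const
  exact hclosed.mem_of_tendsto hT (Filter.eventually_atTop.mpr ⟨S, fun A hA' => hA A hA'⟩)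

/-- **A product of holomorphic factors close to `1` is holomorphic.** If each `F_i` is holomorphic on
an open `U ⊆ ℂ`, `b ≥ 0` is summable and `‖F_i(s) − 1‖ ≤ b_i` for all `i` and `s ∈ U`, then for every
`s ∈ U` the product `∏'_i F_i(s)` converges (Mathlib `multipliable_one_add_of_summable`) and
`s ↦ ∏'_i F_i(s)` is holomorphic on `U` (the finite partial products converge uniformly on `U`).
[folklore] -/
private theorem differentiableOn_tprod_of_summable_bound {ι : Type*} {U : Set ℂ} (hU : IsOpen U)
    {F : ι → ℂ → ℂ} {b : ι → ℝ} (hF : ∀ i, DifferentiableOn ℂ (F i) U) (hb0 : ∀ i, 0 ≤ b i)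
    (hb : Summable b) (hFb : ∀ i, ∀ s ∈ U, ‖F i s - 1‖ ≤ b i) :
    (∀ s ∈ U, Multipliable fun i => F i s) ∧ DifferentiableOn ℂ (fun s => ∏' i, F i s) U := by
  classical
  -- pointwise convergence
  have hmul : ∀ s ∈ U, Multipliable fun i => F i s := by
    intro s hs
    have hsum : Summable fun i => ‖F i s - 1‖ :=
      Summable.of_nonneg_of_le (fun _ => norm_nonneg _) (fun i => hFb i s hs) hb
    have h := multipliable_one_add_of_summable hsum
    simpa only [add_sub_cancel] using h
  refine ⟨hmul, ?_⟩
  -- the uniform estimate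
  set B : ℝ := ∑' i, b i with hBdef
  set T : Finset ι → ℝ := fun A => ∑' i, ((↑A : Set ι)ᶜ).indicator b i with hTdef
  have hest : ∀ (A : Finset ι), ∀ s ∈ U,
      ‖(∏' i, F i s) - ∏ i ∈ A, F i s‖ ≤ Real.exp B * (Real.exp (T A) - 1) := by
    intro A s hs
    have hind0 : ∀ i, 0 ≤ ((↑A : Set ι)ᶜ).indicator b i := fun i =>
      Set.indicator_nonneg (fun j _ => hb0 j) i
    have hind : ∀ i ∉ A, ‖F i s - 1‖ ≤ ((↑A : Set ι)ᶜ).indicator b i := by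
      intro i hi
      rw [Set.indicator_of_mem (by simpa using hi)]
      exact hFb i s hs
    have h1 := norm_hasProd_sub_prod_le (hmul s hs).hasProd A hind0 (hb.indicator _) hind
    have hP : ‖∏ i ∈ A, F i s‖ ≤ Real.exp B := by
      have h2 := norm_prod_sub_one_le A (fun i => F i s)
      have h3 : ∑ i ∈ A, ‖F i s - 1‖ ≤ B :=
        calc ∑ i ∈ A, ‖F i s - 1‖ ≤ ∑ i ∈ A, b i := Finset.sum_le_sum fun i _ => hFb i s hs
          _ ≤ B := hb.sum_le_tsum _ (fun i _ => hb0 i)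
      have h4 : ‖∏ i ∈ A, F i s‖ ≤ ‖∏ i ∈ A, F i s - 1‖ + ‖(1 : ℂ)‖ := by
        have := norm_add_le (∏ i ∈ A, F i s - 1) 1
        rwa [sub_add_cancel] at this
      rw [norm_one] at h4
      linarith [Real.exp_le_exp.mpr h3]
    have hT0 : 0 ≤ Real.exp (T A) - 1 := by
      have : 0 ≤ T A := tsum_nonneg hind0
      linarith [Real.add_one_le_exp (T A)]
    calc ‖(∏' i, F i s) - ∏ i ∈ A, F i s‖ ≤ ‖∏ i ∈ A, F i s‖ * (Real.exp (T A) - 1) := h1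
      _ ≤ Real.exp B * (Real.exp (T A) - 1) := mul_le_mul_of_nonneg_right hP hT0
  -- the tail sums tend to `0`
  have hTlim : Tendsto T atTop (𝓝 0) := by
    have h := tendsto_tsum_compl_atTop_zero b
    refine h.congr fun A => ?_
    rw [hTdef]
    exact (tsum_subtype ((↑A : Set ι)ᶜ) b)
  have hglim : Tendsto (fun A => Real.exp B * (Real.exp (T A) - 1)) atTop (𝓝 0) := by
    have h1 : Tendsto (fun A => Real.exp (T A)) atTop (𝓝 (Real.exp 0)) :=
      (Real.continuous_exp.tendsto 0).comp hTlim
    rw [Real.exp_zero] at h1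
    have h2 : Tendsto (fun A => Real.exp (T A) - 1) atTop (𝓝 (1 - 1)) := h1.sub_const 1
    rw [sub_self] at h2
    simpa using h2.const_mul (Real.exp B)
  -- uniform convergence of the partial products on `U`
  have hunif : TendstoUniformlyOn (fun A s => ∏ i ∈ A, F i s) (fun s => ∏' i, F i s) atTop U := by
    rw [Metric.tendstoUniformlyOn_iff]
    intro ε hε
    filter_upwards [hglim.eventually (gt_mem_nhds hε)] with A hA s hs
    rw [dist_eq_norm]
    exact (hest A s hs).trans_lt hA
  refine hunif.tendstoLocallyUniformlyOn.differentiableOn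
    (Filter.Eventually.of_forall fun A => ?_) hU
  exact DifferentiableOn.fun_finsetProd fun i _ => hF i

/-! ## §2. `ℳ₂(d,l;·)`: convergence, holomorphy and size on `σ > 9/10`, for every `D`, `χ` -/

section CalM2

variable (c' : ℝ) {D : ℕ} [NeZero D] (χ : DirichletCharacter ℂ D)

/-- The half-plane `σ > 9/10` is open. [folklore] -/
private theorem isOpen_U : IsOpen {s : ℂ | 9 / 10 < s.re} :=
  isOpen_lt continuous_const Complex.continuous_re

omit [NeZero D] χ in
/-- `q^{−σ}/q ≤ q^{−19/10}` and `q^{−σ} ≤ 1/q^{9/10}` for `σ ≥ 9/10`, `q ≥ 1`. [folklore] -/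
private theorem rpow_bounds {q : ℕ} (hq : 0 < q) {σ : ℝ} (hσ : 9 / 10 ≤ σ) :
    (q : ℝ) ^ (-σ) / q ≤ (q : ℝ) ^ (-(19 / 10 : ℝ)) ∧
      (q : ℝ) ^ (-σ) ≤ 1 / (q : ℝ) ^ (9 / 10 : ℝ) := by
  have hq0 : (0 : ℝ) < q := by exact_mod_cast hq
  have hq1 : (1 : ℝ) ≤ q := by exact_mod_cast hq
  have h1 : (q : ℝ) ^ (-σ) ≤ (q : ℝ) ^ (-(9 / 10 : ℝ)) :=
    Real.rpow_le_rpow_of_exponent_le hq1 (by linarith)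
  have h2 : (q : ℝ) ^ (-(19 / 10 : ℝ)) = (q : ℝ) ^ (-(9 / 10 : ℝ)) / q := by
    rw [← Real.rpow_sub_one hq0.ne']; norm_num
  have h3 : (q : ℝ) ^ (-(9 / 10 : ℝ)) = 1 / (q : ℝ) ^ (9 / 10 : ℝ) := by
    rw [Real.rpow_neg hq0.le, one_div]
  refine ⟨?_, ?_⟩
  · rw [h2]; exact div_le_div_of_nonneg_right h1 hq0.le
  · rw [← h3]; exact h1

/-- The per-prime majorant `b_q = 225q^{−19/10} + [q ∣ dl]·900/q^{9/10}` bounds `‖F_q(s) − 1‖` for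
every prime `q` and every `σ > 9/10` (`Section16ACalM2Local`), and is summable when `dl ≠ 0`.
[cite: Zhang2022LandauSiegel, §16 p. 91] -/
theorem calM2Factor_sub_one_le_majorant {d l : ℕ} (hd : 1 ≤ d) (hl : 1 ≤ l) :
    (Summable fun q : Nat.Primes =>
        225 * ((q : ℕ) : ℝ) ^ (-(19 / 10 : ℝ)) +
          (if (q : ℕ) ∣ d * l then 900 / ((q : ℕ) : ℝ) ^ (9 / 10 : ℝ) else 0)) ∧
      ∀ q : Nat.Primes, ∀ s ∈ {s : ℂ | 9 / 10 < s.re},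
        ‖calM2Factor c' χ (q : ℕ) d l s - 1‖ ≤
          225 * ((q : ℕ) : ℝ) ^ (-(19 / 10 : ℝ)) +
            (if (q : ℕ) ∣ d * l then 900 / ((q : ℕ) : ℝ) ^ (9 / 10 : ℝ) else 0) := by
  classical
  have hdl0 : 0 < d * l := Nat.mul_pos hd hl
  refine ⟨?_, ?_⟩
  · have hb1 : Summable fun q : Nat.Primes => 225 * ((q : ℕ) : ℝ) ^ (-(19 / 10 : ℝ)) := by
      have h : Summable fun n : ℕ => (n : ℝ) ^ (-(19 / 10 : ℝ)) :=
        Real.summable_nat_rpow.mpr (by norm_num)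
      exact (h.comp_injective Subtype.val_injective).mul_left 225
    set S₂ : Finset Nat.Primes := (d * l).primeFactors.subtype Nat.Prime with hS₂def
    have hb2 : Summable fun q : Nat.Primes =>
        (if (q : ℕ) ∣ d * l then 900 / ((q : ℕ) : ℝ) ^ (9 / 10 : ℝ) else 0) := by
      refine summable_of_ne_finset_zero (s := S₂) fun q hq' => ?_
      have hndvd : ¬ (q : ℕ) ∣ d * l := fun h =>
        hq' (Finset.mem_subtype.mpr (Nat.mem_primeFactors.mpr ⟨q.prop, h, hdl0.ne'⟩))
      rw [if_neg hndvd]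
    exact hb1.add hb2
  · intro q s hs
    have hs' : 9 / 10 < s.re := hs
    have hqprime : (q : ℕ).Prime := q.prop
    have hq0 : (0 : ℝ) < ((q : ℕ) : ℝ) := by exact_mod_cast hqprime.pos
    obtain ⟨r1, r2⟩ := rpow_bounds hqprime.pos hs'.le
    have hnn1 : 0 ≤ 225 * ((q : ℕ) : ℝ) ^ (-(19 / 10 : ℝ)) := by positivity
    have hnn2 : 0 ≤ (if (q : ℕ) ∣ d * l then 900 / ((q : ℕ) : ℝ) ^ (9 / 10 : ℝ) else 0) := by
      split_ifs <;> positivity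
    by_cases hc : Nat.Coprime (q : ℕ) (d * l)
    · have h := norm_calM2Factor_sub_one_le_of_coprime c' χ hqprime hc hs'.le
      have h' : ‖calM2Factor c' χ (q : ℕ) d l s - 1‖ ≤ 225 * ((q : ℕ) : ℝ) ^ (-(19 / 10 : ℝ)) :=
        calc _ ≤ 225 * ((q : ℕ) : ℝ) ^ (-s.re) / (q : ℕ) := h
          _ = 225 * (((q : ℕ) : ℝ) ^ (-s.re) / (q : ℕ)) := by ring
          _ ≤ 225 * ((q : ℕ) : ℝ) ^ (-(19 / 10 : ℝ)) := by gcongr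
      linarith
    · have h := norm_calM2Factor_sub_one_le c' χ hqprime d l hs'.le
      have hdvd : (q : ℕ) ∣ d * l := not_not.mp (mt hqprime.coprime_iff_not_dvd.mpr hc)
      have h' : ‖calM2Factor c' χ (q : ℕ) d l s - 1‖ ≤ 900 / ((q : ℕ) : ℝ) ^ (9 / 10 : ℝ) :=
        calc _ ≤ 900 * ((q : ℕ) : ℝ) ^ (-s.re) := h
          _ ≤ 900 * (1 / ((q : ℕ) : ℝ) ^ (9 / 10 : ℝ)) := by gcongr
          _ = 900 / ((q : ℕ) : ℝ) ^ (9 / 10 : ℝ) := by ring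
      rw [if_pos hdvd]
      linarith

/-- **`ℳ₂(d,l;·)` converges and is holomorphic on `σ > 9/10`** (DAG `Z22:§16.u021`, analytic part;
§16 p. 91 "is analytic"), for every modulus `D`, every character `χ` and all `d, l ≥ 1`: the Euler
product `∏'_q calM2Factor` of holomorphic factors with `‖F_q(s) − 1‖ ≤ b_q`, `Σ b_q < ∞`.
[cite: Zhang2022LandauSiegel, §16 p. 91] -/
theorem calM2_multipliable_differentiableOn {d l : ℕ} (hd : 1 ≤ d) (hl : 1 ≤ l) :
    (∀ s : ℂ, 9 / 10 < s.re → Multipliable fun q : Nat.Primes => calM2Factor c' χ (q : ℕ) d l s) ∧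
      DifferentiableOn ℂ (calM2 c' χ d l) {s : ℂ | 9 / 10 < s.re} := by
  obtain ⟨hbsum, hFb⟩ := calM2Factor_sub_one_le_majorant c' χ hd hl
  have hb0 : ∀ q : Nat.Primes, 0 ≤ 225 * ((q : ℕ) : ℝ) ^ (-(19 / 10 : ℝ)) +
      (if (q : ℕ) ∣ d * l then 900 / ((q : ℕ) : ℝ) ^ (9 / 10 : ℝ) else 0) := fun q => by
    have hq0 : (0 : ℝ) < ((q : ℕ) : ℝ) := by exact_mod_cast q.prop.pos
    split_ifs <;> positivity
  have hfac : ∀ q : Nat.Primes,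
      DifferentiableOn ℂ (fun s => calM2Factor c' χ (q : ℕ) d l s) {s : ℂ | 9 / 10 < s.re} :=
    fun q => differentiableOn_calM2Factor c' χ q.prop d l
  obtain ⟨hmul, hdiff⟩ := differentiableOn_tprod_of_summable_bound isOpen_U hfac hb0 hbsum hFb
  exact ⟨fun s hs => hmul s hs, hdiff⟩

/-- **`‖ℳ₂(d,l;s)‖ ≤ K·∏_{q∣dl}(1 + 900/q^{9/10})`** for `σ > 9/10`, `d, l ≥ 1`, every `D`, `χ`, with
`K = exp(225·Σ'_q q^{−19/10})` (DAG `Z22:§16.u022`): every finite partial product of the Euler product is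
bounded by `∏_q (1 + ‖F_q − 1‖) ≤ exp(Σ_{q} 225q^{−19/10})·∏_{q∣dl}(1 + 900/q^{9/10})`, and the bound
passes to the limit. [cite: Zhang2022LandauSiegel, §16 p. 91] -/
theorem norm_calM2_le {d l : ℕ} (hd : 1 ≤ d) (hl : 1 ≤ l) {s : ℂ} (hs : 9 / 10 < s.re) :
    ‖calM2 c' χ d l s‖ ≤
      Real.exp (225 * ∑' q : Nat.Primes, ((q : ℕ) : ℝ) ^ (-(19 / 10 : ℝ))) *
        ∏ q ∈ (d * l).primeFactors, (1 + 900 / (q : ℝ) ^ (9 / 10 : ℝ)) := by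
  classical
  have hdl0 : 0 < d * l := Nat.mul_pos hd hl
  obtain ⟨-, hFb'⟩ := calM2Factor_sub_one_le_majorant c' χ hd hl
  obtain ⟨hmul, -⟩ := calM2_multipliable_differentiableOn c' χ hd hl
  -- the global majorant over the primes and the global constant
  set x : Nat.Primes → ℝ := fun q => 225 * ((q : ℕ) : ℝ) ^ (-(19 / 10 : ℝ)) with hxdef
  have hx0 : ∀ q, 0 ≤ x q := fun q => by positivity
  have hxsum : Summable x := by
    have h : Summable fun n : ℕ => (n : ℝ) ^ (-(19 / 10 : ℝ)) :=
      Real.summable_nat_rpow.mpr (by norm_num)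
    exact (h.comp_injective Subtype.val_injective).mul_left 225
  set K : ℝ := Real.exp (225 * ∑' q : Nat.Primes, ((q : ℕ) : ℝ) ^ (-(19 / 10 : ℝ))) with hK
  have hKx : Real.exp (∑' q, x q) = K := by
    rw [hK, hxdef, tsum_mul_left]
  set F : Nat.Primes → ℂ := fun q => calM2Factor c' χ (q : ℕ) d l s with hF
  have hHP : HasProd F (calM2 c' χ d l s) := (hmul s hs).hasProd
  -- the local majorants
  set y : Nat.Primes → ℝ := fun q =>
    if (q : ℕ) ∣ d * l then 900 / ((q : ℕ) : ℝ) ^ (9 / 10 : ℝ) else 0 with hydef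
  have hy0 : ∀ q, 0 ≤ y q := fun q => by
    have hq0 : (0 : ℝ) < ((q : ℕ) : ℝ) := by exact_mod_cast q.prop.pos
    simp only [hydef]; split_ifs <;> positivity
  have hFb : ∀ q : Nat.Primes, ‖F q - 1‖ ≤ x q + y q := fun q => hFb' q s hs
  -- the target bound
  set Pdl : ℝ := ∏ q ∈ (d * l).primeFactors, (1 + 900 / (q : ℝ) ^ (9 / 10 : ℝ)) with hPdl
  set B : ℝ := K * Pdl with hB
  -- every finite partial product is bounded by `B`
  have hAll : ∀ A : Finset Nat.Primes, ‖∏ q ∈ A, F q‖ ≤ B := by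
    intro A
    have h1 : ‖∏ q ∈ A, F q‖ ≤ ∏ q ∈ A, (1 + (x q + y q)) :=
      (norm_prod_le_prod_one_add_norm_sub_one A F).trans
        (Finset.prod_le_prod (fun q _ => by positivity) fun q _ => by linarith [hFb q])
    have h2 : ∏ q ∈ A, (1 + (x q + y q)) ≤ (∏ q ∈ A, (1 + x q)) * ∏ q ∈ A, (1 + y q) := by
      rw [← Finset.prod_mul_distrib]
      exact Finset.prod_le_prod (fun q _ => by linarith [hx0 q, hy0 q]) fun q _ => by
        nlinarith [hx0 q, hy0 q]
    have h3 : ∏ q ∈ A, (1 + x q) ≤ K := by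
      refine (prod_one_add_le_exp_sum A hx0).trans ?_
      rw [← hKx]
      exact Real.exp_le_exp.mpr (hxsum.sum_le_tsum A fun q _ => hx0 q)
    have h4 : ∏ q ∈ A, (1 + y q) ≤ Pdl := by
      set g : ℕ → ℝ := fun n => 1 + 900 / (n : ℝ) ^ (9 / 10 : ℝ) with hg
      have hg1 : ∀ n, 1 ≤ g n := fun n => by
        have : 0 ≤ 900 / (n : ℝ) ^ (9 / 10 : ℝ) := by positivity
        simp only [hg]; linarith
      set A' : Finset Nat.Primes := A.filter (fun q : Nat.Primes => (q : ℕ) ∣ d * l) with hA'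
      have hrw : ∏ q ∈ A, (1 + y q) = ∏ q ∈ A', g q := by
        rw [hA', Finset.prod_filter]
        refine Finset.prod_congr rfl fun q _ => ?_
        by_cases hqd : (q : ℕ) ∣ d * l
        · simp only [hydef, hg, if_pos hqd]
        · simp only [hydef, hg, if_neg hqd, add_zero]
      have himg : ∏ n ∈ A'.image (fun q : Nat.Primes => (q : ℕ)), g n = ∏ q ∈ A', g q :=
        Finset.prod_image fun q _ q' _ h => Subtype.val_injective h
      have hsub : A'.image (fun q : Nat.Primes => (q : ℕ)) ⊆ (d * l).primeFactors := by
        intro n hn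
        obtain ⟨q, hq', rfl⟩ := Finset.mem_image.mp hn
        exact Nat.mem_primeFactors.mpr ⟨q.prop, (Finset.mem_filter.mp hq').2, hdl0.ne'⟩
      calc ∏ q ∈ A, (1 + y q) = ∏ q ∈ A', g q := hrw
        _ = ∏ n ∈ A'.image (fun q : Nat.Primes => (q : ℕ)), g n := himg.symm
        _ ≤ ∏ n ∈ (d * l).primeFactors, g n :=
            prod_le_prod_of_subset_of_one_le_real hsub fun n _ => hg1 n
        _ = Pdl := by rw [hPdl]
    have hK0 : 0 ≤ K := (Real.exp_pos _).le
    have hP1 : 0 ≤ ∏ q ∈ A, (1 + y q) := Finset.prod_nonneg fun q _ => by linarith [hy0 q]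
    calc ‖∏ q ∈ A, F q‖ ≤ (∏ q ∈ A, (1 + x q)) * ∏ q ∈ A, (1 + y q) := h1.trans h2
      _ ≤ K * Pdl := mul_le_mul h3 h4 hP1 hK0
  -- pass to the limit of the unconditional product
  have hT : Tendsto (fun A : Finset Nat.Primes => ∏ q ∈ A, F q) atTop (𝓝 (calM2 c' χ d l s)) := hHP
  have hclosed : IsClosed {z : ℂ | ‖z‖ ≤ B} := isClosed_le continuous_norm continuous_const
  have hmem := hclosed.mem_of_tendsto hT (Filter.Eventually.of_forall hAll)
  simpa only [hB, hPdl, Set.mem_setOf_eq] using hmem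

end CalM2

/-! ## §3. The nodes -/

/-- **`Z22:§16.u021` (analytic part) HOLDS**: for every `c′` (and in fact every `D`, `χ`, with no
Assumption (A)), `s ↦ ℳ₂(d,l;s)` is holomorphic on `σ > 9/10` for all `d, l ≥ 1` — the typed node
`Typed.Section16A.Step16_u021an` BY NAME. [cite: Zhang2022LandauSiegel, §16 p. 91] -/
theorem step16_u021an_holds (c' : ℝ) : Step16_u021an c' :=
  ⟨0, fun _D _ χ _ _ _ _d _l hd hl => (calM2_multipliable_differentiableOn c' χ hd hl).2⟩

variable (c' : ℝ) in
/-- `Step16_u021an` — `_holds` alias of `step16_u021an_holds` above under the fact's exact name, stated under the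
prover's own binders as section variables (appended 2026-08-28, D-0026 bookkeeping: the proof term is the
existing theorem of this file; no statement, definition or attribute is edited; no new named fact; the
ledger's debt table listed the fact unproved). [cite: Zhang2022LandauSiegel, §16 p. 91] -/
theorem _root_.Literature.NumberTheory.LFunctions.Zhang2022.Typed.Section16A.Step16_u021an_holds :
    _root_.Literature.NumberTheory.LFunctions.Zhang2022.Typed.Section16A.Step16_u021an c' :=
  _root_.Literature.NumberTheory.LFunctions.Zhang2022.Typed.Section16A.step16_u021an_holds (c' := c')

/-- **`Z22:§16.u022` HOLDS**: for every `c′` (and every `D`, `χ`, no Assumption (A)), with `c = 900`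
and `C = exp(225·Σ'_q q^{−19/10})`: `‖ℳ₂(d,l;s)‖ ≤ C·∏_{q∣dl}(1 + c/q^{9/10})` for `σ > 9/10`,
`d, l ≥ 1` — the typed node `Typed.Section16A.Step16_u022` BY NAME ("`ℳ₂(d,l;s) ≪ ∏_{q∣dl}(1 + cq^{−9/10})`",
§16 p. 91). [cite: Zhang2022LandauSiegel, §16 p. 91] -/
theorem step16_u022_holds (c' : ℝ) : Step16_u022 c' :=
  ⟨900, Real.exp (225 * ∑' q : Nat.Primes, ((q : ℕ) : ℝ) ^ (-(19 / 10 : ℝ))), 0,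
    fun _D _ χ _ _ _ _d _l hd hl _s hs => norm_calM2_le c' χ hd hl hs⟩

variable (c' : ℝ) in
/-- `Step16_u022` — `_holds` alias of `step16_u022_holds` above under the fact's exact name, stated under the
prover's own binders as section variables (appended 2026-08-28, D-0026 bookkeeping: the proof term is the
existing theorem of this file; no statement, definition or attribute is edited; no new named fact; the
ledger's debt table listed the fact unproved). [cite: Zhang2022LandauSiegel, §16 p. 91] -/
theorem _root_.Literature.NumberTheory.LFunctions.Zhang2022.Typed.Section16A.Step16_u022_holds :
    _root_.Literature.NumberTheory.LFunctions.Zhang2022.Typed.Section16A.Step16_u022 c' :=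
  _root_.Literature.NumberTheory.LFunctions.Zhang2022.Typed.Section16A.step16_u022_holds (c' := c')

end Literature.NumberTheory.LFunctions.Zhang2022.Typed.Section16A
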